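import Summits.QuantumFields.YangMills.Theorems.BackwardLiouvilleRigidityOneStepBackwardContractionAdmDescentDisintegration
import HarnessLib

/-!
R-CUT-χ (2026-08-30 ≈19:3xZ, g26; LEAD w3 g23 WORD №1 (iii) «R-CUT-χ», ideator №3 GO): the `sfCut` numerals (½, ¾) ↦ (½, 24∕25) —
`sfCut θ U = ∏ p, max 0 (min 1 ((24/25·θ − dist1 (plaqHol U p)) / ((24/25 − 1/2)·θ)))`: `= 1` iff every `dist1 ≤ θ/2` (unchanged), `= 0` iff some
`dist1 ≥ (24/25)θ`, `{sfCut > 0} = {PlaqSmall ((24/25)θ)}` — so that the one-step spread lifts the fibre-mean rows need exist for EVERY odd block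
size `L ≥ 3` from LANDED kernels (gain `0.9482·` at `L = 3` < 24/25; LEAD (M3) letter).  Every row ∕ junction text not naming the constant is
byte-identical to the previous version.

# LINE g26-1 «mode_section» v1.1 — the tangent row LIN∘ re-cut with the Laplace expansion CENTRED AT THE FIBRE-MODE OF THE
# REFERENCE TOWER (lens «control»: a co-moving centre instead of an external classical section)
# (crux stmt-QuantumFields-20520 `FluctuationComparisonRegPrIntL`; docks BY NAME on `OrganTangent.TangentTransportCan` (LIN∘) and on
# `OrganTangent.OneStepContractionRun` (O1 v17.1 text) of `Lines/organ_tangent.lean` v2.5 — restated here BY TEXT, byte-identical bodies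
# (the farm does not build `Lines/` modules for import; the restated copies are the docking texts, E2E by `Iff.rfl` as w4 g21 (4));
# sibling of LINE g25-2 `Lines/tangent_classical_quantum.lean` v2.5 (c1ea97750265c754), whose rows 2–3 it RE-CENTRES — see P26-1.)

P26-1 (self-audit of g25-2 by its author, 2026-08-30, g26).  g25-2 cuts LIN∘ as `m = h∘U⋆_W + (m − h∘U⋆_W)` with `U⋆_W` a fibre-minimiser
of the ONE-STEP Wilson action `wilsonAction4` (MIN∘).  But `m = E′_χ[h | V]` is the mean of `h` under the (cut) fibre law `χ·ρ′_{j+1} dσ_V` of the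
REFERENCE tower, and that law is centred at the fibre-MODE of `ρ′_{j+1}`.  For a tower that is `n′ = K′ − j − 1 ≥ 1` averaging steps deep —
always, in O1's anchored frame (v17: the towers ARE the runs ∕ their SF-cuts), and for every class member in the old generic frame — the mode is
the reference run's `n′`-STEP background (the fibre-minimiser of its `n′`-step tree action, [Balaban1985Variational] (8) with `k = n′`) up to an
`O(g_{j+1}²)` quantum shift, and it is displaced from `U⋆_W` CLASSICALLY: `δU := U_mode − U⋆_W = O(κ_geom)` in units of the natural fibre scale,
zeroth order in `g`.  Gaussian model (the quadratic tower of HOME `g25/toy/fp_transport_2d_pure.py`): reference precision `Q_{n′}` (the `n′`-step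
form), fibre `{φ : Aφ = ψ}`, sections `M_Q ψ := Q⁻¹Aᵀ(AQ⁻¹Aᵀ)⁻¹ψ`; for a discrepancy form `h(φ) = φᵀDφ`:
`m(ψ) = E′[h | ψ] = ψᵀ M_{Q_{n′}}ᵀ D M_{Q_{n′}} ψ + tr(G_{n′} D)` EXACTLY, whereas g25-2's classical part is `h(M_{Q_W}ψ) = ψᵀM_{Q_W}ᵀ D M_{Q_W}ψ`;
so `m − h∘U⋆_W` is the coarse form `M_{n′}ᵀDM_{n′} − M_WᵀDM_W` (+ a constant), FIRST order in `M_{n′} − M_W ≠ 0` (`Q_{n′} ≠ Q_W` for `n′ ≥ 1`: one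
FP-recursion step already moves ≈ 20–30 % of the form off the nearest-neighbour stencil, census g25 B-8 ∕ toy table), i.e. of size `O(κ_geom)·x` —
not `ε_j·x` (FLUC∘'s budget; `ε_j → 0`), and not inside BGEV∘'s `(1 + ε_j + εd_n)` either: the equilibration heuristic behind `εd_n` — the FP
recursion `Q_{n+1} = M_{Q_n}ᵀ Q_n M_{Q_n}` — transports every form through ITS OWN fibre-minimiser, never through `M_W`.  (For the declared Wilson
part the first-order term does vanish — `Q_W M_W ψ ∈ range Aᵀ ⊥ ker A ∋ δMψ` — leaving `½a·δMᵀQ_WδM = O(κ_geom²)·a`, still not `ε_j`-small.)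
VERDICT: FLUC∘ (g25-2 row 3) is FALSE in the Gaussian model of the frame and very likely false as typed; BGEV∘ (row 2) is mis-centred and keeps
its claimed factor only while the discrepancy is dominated by contracting directions (room `1 − λ`); MIN∘ (row 1), the junction ★3 (valid, but
fed an unfulfillable hypothesis), LIN∘ ∕ VER∘ ∕ JEN∘ (organ_tangent: section-free), COAREA∘ ∕ PINCH∘ (version_coarea) and O1 ∕ S-rows ∕ the package
are UNAFFECTED.  No Lean refutation is claimed: the rows are organ-level Props about Bałaban's densities and the model computation is the
evidence (cheapest falsifier of FLUC∘, run by hand: two lines of linear algebra above; instrument FL-17 (2a) can print `‖M_{n′}ᵀDM_{n′} − M_WᵀDM_W‖/‖D‖`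
for `n′ = 1…12` from the matrices it already builds).  The repair is THIS line.

THE RE-CENTRED CUT.  Replace MIN∘'s external Wilson section by the INTRINSIC centre of the reference fibre law: a section `U_m : window_j → fine
window` of FIBRE-MODES of `ρ′_{j+1}` — `ρ′_{j+1}(U) ≤ ρ′_{j+1}(U_m V)` for every fine-window `U` over `V` — continuous on the coarse window, valued in
the HALF fine window `{PlaqSmall θ_{j+1}/2}` (where `χ = sfCut θ_{j+1} = 1`).  It is typed INSIDE O1's frame (it needs `ρ′`) over existing
declarations only, no new objects:
  MODE∘ `ModeSectionCan`        — existence of a continuous fibre-mode section (row 1; replaces MIN∘; frame-internal);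
  TRM∘  `ModeTransportCan`      — transport of `h` through `U_m`: the TEXT of BGEV∘ with MIN∘'s section property replaced by MODE∘'s (same
                                   currency, same profiles `ε, εd, δ`, same `(1 + ε_j + εd_n)·x + δ_j`);
  LAP∘  `LaplaceCorrectionCan`  — the Laplace correction `m − h∘U_m` is `ε`-small: the TEXT of FLUC∘ with the section property replaced.
In the Gaussian model `U_m = M_{Q_{n′}}ψ` exactly, TRM∘'s output is `M_{n′}ᵀDM_{n′}` (the true transported form) and LAP∘'s difference is the
constant `tr(G D)` — ZERO 4-point content: LAP∘ holds there with `ε = 0`.  Beyond the model the first-order Laplace term about the mode is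
`⟨∇h(U_mV), E′_χ[ζ | V]⟩` with `E′_χ[ζ | V]` = the mean displacement of the fibre law FROM ITS OWN MODE = `O(third cumulant × variance²) =
O(g_{j+1}²)` in lattice units — genuinely quantum now — and the second-order term `½ tr(G_V ∇²h)` as in FLUC∘'s mechanism.  The KT-W bet (i) and
the pull-back bet (ii) of BGEV∘ pass to TRM∘ UNCHANGED IN KIND but now match their own heuristic: `U_m` is (up to `O(g²)`) the reference run's
multi-step background, through which the reference run's tree action is transported EXACTLY (composition of constrained minima,
[Balaban1985Variational] (8)) and along which the FP-recursion equilibration picture (arXiv:hep-lat/9506030 §3) applies literally.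

Junctions (kernel-checked, no sorry): ★M3 `tangentTransport_of_modeCut : MODE∘ → TRM∘ → LAP∘ → OrganTangent.TangentTransportCan` (the algebra of
g25-2's ★3 — `m = h∘U_m + (m − h∘U_m)`, presentations add, `|Σ(c₁+c₂)| ≤ …` — with the section now obtained INSIDE the frame from MODE∘), ★M5
`oneStepContractionRun_of_modeCut : VER∘ → MODE∘ → TRM∘ → LAP∘ → JEN∘ → OrganTangent.OneStepContractionRun` (composition with organ_tangent's
★ `oneStepContractionRun_of_tangentCut`, re-proved here verbatim as ★M4).  Sorries = 3 = stubs {MODE∘, TRM∘, LAP∘}.  O1's text = organ_tangent's restated copy,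
byte-identical with `RunPairOrgan.OneStepContractionRun` v17.1 (w4 g21 E2E (4) `Iff.rfl`, sigHash 046b2be4911fdd1c).
KT-W honoured exactly as BGEV∘∕O1 (B-8(a): O1's tower block verbatim, `j + 2 ≤ T`; a Wilson-exact un-equilibrated input still spreads by
`κ_geom·θ` through ANY section — TRM∘'s declared risk (i)).  Cheapest falsifier of the LINE: a class-admissible reference density with TWO
fibre-mode orbits inside the window over some window datum (MODE∘'s global maximality∕continuity dies) — equivalently, failure of the tree
action's transversal fibre-convexity `c·β_{j+1}/L²` to dominate `sup |∇²_fibre q′|` on the window at all large `j`.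
HONEST: model-level diagnosis, organ-level rows; nothing of Bałaban's is asserted; MODE∘ ∕ TRM∘ ∕ LAP∘, LIN∘, O1, S1a ∕ S2α′ ∕ S2β ∕ the 26243 door,
20520 and `YM3TorusSU2` are NOT proved; R3 = SU(2) YM₃ on T³ via Bałaban's UV-stability programme — NOT d = 4, NOT infinite volume, NOT a mass
gap, NOT Clay.  No summit is proved by a line.
-/

open MeasureTheory Filter Topology
open Literature.MathematicalPhysics.QuantumFieldTheory.Balaban1983to89 T3ContinuumYM3Torus T3NestedUnitLaws
  T3UnitLawDensityEML T4Continuum BalabanUVClass T3UnitScaleTilt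
namespace Summit.QuantumFields.YangMills.Cruxes.FluctuationComparisonRegPrIntL.ModeSection

/-- The CONTINUOUS SMALL-FIELD CUTOFF on fine fields (restated BY TEXT from organ_tangent.lean v2.1, byte-identical: support `{∀ p, dist1 ≤ (24∕25)θ}`,
compact inside the open window `{PlaqSmall θ}`; `= 1` on `{∀ p, dist1 ≤ θ/2}`). -/
noncomputable def sfCut {P : Params} {k : ℕ} (θ : ℝ) (U : GaugeField P k ↥(Matrix.specialUnitaryGroup (Fin 2) ℂ)) : ℝ :=
  ∏ p : Plaq P k, max 0 (min 1 ((24 / 25 * θ - dist1 (GaugeField.plaqHol U p)) / ((24 / 25 - 1 / 2) * θ)))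

/-- O1 · the one-step organ (v17 = R-c + R-a + R-n4), restated BY TEXT (byte-identical with `RunPairOrgan.OneStepContractionRun` of runpair_organ v17.1 (smooth cut),
HOME bytes `runpair_organ.v171.lean`, and with `OrganTangent.OneStepContractionRun` v2.5). -/
def OneStepContractionRun : Prop :=
  ∃ γ₁ : ℝ, 0 < γ₁ ∧ ∀ (F : T3Family) (γ : ℝ), 0 < γ → γ ≤ γ₁ → ∀ (b₀ p₀ : ℝ) (j₀ : ℕ) (prm : ℕ → ClassParams) (η : ℕ → ℝ), 0 < b₀ → 0 < p₀ → AdmissibleClassParams F γ b₀ p₀ prm → (∀ j, 0 ≤ η j) → Summable η → Summable (fun i => ∑' k, η (k + i)) → Tendsto (fun j => (∑' k, η (k + j)) * ((1 + 2 * ((F.L : ℝ) ^ j / γ) * (Fintype.card (Plaq (F.P j) 0) : ℝ)) * (Fintype.card (PBond (F.P j) 0) : ℝ) ^ 2)) atTop (𝓝 0) → ∃ κ₀ : ℝ, 0 < κ₀ ∧ ∀ (κ : ℝ), 0 < κ → κ ≤ κ₀ → ∃ (θ C w₀ : ℝ) (ε εd δ : ℕ → ℝ) (j₁ : ℕ),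 0 < θ ∧ 0 ≤ C ∧ 0 < w₀ ∧ (∀ j, 0 ≤ ε j ∧ 0 ≤ εd j ∧ 0 ≤ δ j) ∧ Summable ε ∧ Summable εd ∧ Summable δ ∧ Summable (fun i => ∑' k, δ (k + i)) ∧ Tendsto (fun j => (∑' k, δ (k + j)) * ((1 + 2 * ((F.L : ℝ) ^ j / γ) * (Fintype.card (Plaq (F.P j) 0) : ℝ)) * (Fintype.card (PBond (F.P j) 0) : ℝ) ^ 2)) atTop (𝓝 0) ∧ j₀ ≤ j₁ ∧ ∀ (ν : ℕ → (j : ℕ) → MeasureTheory.Measure (GaugeField (F.P j) 0 ↥(Matrix.specialUnitaryGroup (Fin 2) ℂ))), (∀ K, ν K K = T4GenFunBounds.gibbsMeasure (F.P K) ((F.scheme ℰp γ).β K)) → (∀ K j, j < K → ν K j = Measure.map (descend F ℰp j) (ν K (j + 1))) → ∀ (K K' : ℕ), K ≤ K' → ∀ (Ts T : ℕ), Ts < T → T ≤ K → ∀ (μ μ' : ((j : ℕ) → MeasureTheory.Measure (GaugeField (F.P j) 0 ↥(Matrix.specialUnitaryGroup (Fin 2) ℂ)))) (ρ ρ' : ((j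 : ℕ) → GaugeField (F.P j) 0 ↥(Matrix.specialUnitaryGroup (Fin 2) ℂ) → ℝ)), (∀ j : ℕ, Ts ≤ j → j ≤ T → μ j = ν K j ∧ μ' j = ν K' j) → (∀ j : ℕ, j < Ts → μ j = Measure.map (descend F ℰp j) ((μ (j + 1)).withDensity (fun U => ENNReal.ofReal (sfCut (θBal F.L γ b₀ p₀ (j + 1)) U))) ∧ μ' j = Measure.map (descend F ℰp j) ((μ' (j + 1)).withDensity (fun U => ENNReal.ofReal (sfCut (θBal F.L γ b₀ p₀ (j + 1)) U)))) → (∀ j : ℕ, Ts ≤ j → j < T → μ j = Measure.map (descend F ℰp j) (μ (j + 1)) ∧ μ' j = Measure.map (descend F ℰp j) (μ' (j + 1))) → (∀ j : ℕ, j ≤ T → IsFiniteMeasure (μ j) ∧ IsFiniteMeasure (μ' j)) → (∀ j : ℕ, j₀ ≤ j → j ≤ T → ((∀ U, PlaqSmall (θBal F.L γ b₀ p₀ j) U → 0 < ρ j U ∧ 0 < ρ' j U) ∧ μ j = (fieldMeasure _ _ _).withDensity (fun U => ENNReal.ofReal (ρ j U)) ∧ μ' j = (fieldMeasure _ _ _).withDensity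 (fun U => ENNReal.ofReal (ρ' j U)) ∧ (∃ κ : ℝ, MemAtHeight F ℰp j (prm j) (fun U => Real.exp κ * ρ j U)) ∧ (∃ κ : ℝ, MemAtHeight F ℰp j (prm j) (fun U => Real.exp κ * ρ' j U)) ∧ μ j {U | ¬ PlaqSmall (θBal F.L γ b₀ p₀ j) U} ≤ ENNReal.ofReal (η j) ∧ μ' j {U | ¬ PlaqSmall (θBal F.L γ b₀ p₀ j) U} ≤ ENNReal.ofReal (η j) ∧ (ContinuousOn (ρ j) {U | PlaqSmall (θBal F.L γ b₀ p₀ j) U} ∧ ContinuousOn (ρ' j) {U | PlaqSmall (θBal F.L γ b₀ p₀ j) U}))) → ∀ (j : ℕ), j₁ ≤ j → j + 2 ≤ T → j + 1 ≤ Ts → ∀ (c : Plaq (F.P (j + 1)) 0 → ℝ) (a w : ℝ), 0 ≤ a → 0 ≤ w → a + θ / (((F.L : ℝ) ^ (j + 1) / γ) * θBal F.L γ b₀ p₀ (j + 1) ^ 2) * w ≤ w₀ → ((∀ p, |c p| ≤ a) ∧ (∀ (b b' : PBond (F.P (j + 1)) 0) U V W Z, PlaqSmall (θBal F.L γ b₀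 p₀ (j + 1)) U → PlaqSmall (θBal F.L γ b₀ p₀ (j + 1)) V → PlaqSmall (θBal F.L γ b₀ p₀ (j + 1)) W → PlaqSmall (θBal F.L γ b₀ p₀ (j + 1)) Z → (∀ e, e ≠ b → U e = V e) → (∀ e, e ≠ b' → U e = W e) → (∀ e, e ≠ b' → V e = Z e) → (∀ e, e ≠ b → W e = Z e) → |(Real.log (ρ (j + 1) U) - Real.log (ρ' (j + 1) U) - ((F.L : ℝ) ^ (j + 1) / γ) * ∑ p, c p * (1 - reTr (GaugeField.plaqHol U p))) - (Real.log (ρ (j + 1) V) - Real.log (ρ' (j + 1) V) - ((F.L : ℝ) ^ (j + 1) / γ) * ∑ p, c p * (1 - reTr (GaugeField.plaqHol V p))) - ((Real.log (ρ (j + 1) W) - Real.log (ρ' (j + 1) W) - ((F.L : ℝ) ^ (j + 1) / γ) * ∑ p, c p * (1 - reTr (GaugeField.plaqHol W p))) - (Real.log (ρ (j + 1) Z) - Real.log (ρ' (j + 1) Z) - ((F.L : ℝ) ^ (j + 1) / γ) * ∑ p, c p * (1 - reTr (GaugeField.plaqHol Z p))))| ≤ w * Real.exp (-(κ * (b.src.tdist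 b'.src : ℝ))))) → ∃ (c' : Plaq (F.P j) 0 → ℝ) (a' w' : ℝ), 0 ≤ a' ∧ 0 ≤ w' ∧ a' + θ / (((F.L : ℝ) ^ j / γ) * θBal F.L γ b₀ p₀ j ^ 2) * w' ≤ (1 + ε j + εd (T - (j + 2)) + C * (a + θ / (((F.L : ℝ) ^ (j + 1) / γ) * θBal F.L γ b₀ p₀ (j + 1) ^ 2) * w)) * (a + θ / (((F.L : ℝ) ^ (j + 1) / γ) * θBal F.L γ b₀ p₀ (j + 1) ^ 2) * w) + δ j ∧ ((∀ p, |c' p| ≤ a') ∧ (∀ (b b' : PBond (F.P j) 0) U V W Z, PlaqSmall (θBal F.L γ b₀ p₀ j) U → PlaqSmall (θBal F.L γ b₀ p₀ j) V → PlaqSmall (θBal F.L γ b₀ p₀ j) W → PlaqSmall (θBal F.L γ b₀ p₀ j) Z → (∀ e, e ≠ b → U e = V e) → (∀ e, e ≠ b' → U e = W e) → (∀ e, e ≠ b' → V e = Z e) → (∀ e, e ≠ b → W e = Z e) → |(Real.log (ρ j U) - Real.log (ρ' j U) - ((F.L : ℝ) ^ j / γ) * ∑ p, c' p * (1 - reTr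 (GaugeField.plaqHol U p))) - (Real.log (ρ j V) - Real.log (ρ' j V) - ((F.L : ℝ) ^ j / γ) * ∑ p, c' p * (1 - reTr (GaugeField.plaqHol V p))) - ((Real.log (ρ j W) - Real.log (ρ' j W) - ((F.L : ℝ) ^ j / γ) * ∑ p, c' p * (1 - reTr (GaugeField.plaqHol W p))) - (Real.log (ρ j Z) - Real.log (ρ' j Z) - ((F.L : ℝ) ^ j / γ) * ∑ p, c' p * (1 - reTr (GaugeField.plaqHol Z p))))| ≤ w' * Real.exp (-(κ * (b.src.tdist b'.src : ℝ)))))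

/-- VER∘ (v2) · window-continuous version of the LOCALISED fibre mean `E′_χ[h | ·]` (g25-1 row 1 v2, restated BY TEXT, byte-identical with
`OrganTangent.FibreMeanVersionCan`; its stub lives in organ_tangent.lean). -/
def FibreMeanVersionCan : Prop :=
  ∀ (F : T3Family) (γ b₀ p₀ : ℝ), 0 < γ → γ ≤ 1 → 0 < b₀ → 0 < p₀ → ∃ jV : ℕ, ∀ (j₀ : ℕ) (prm : ℕ → ClassParams) (η : ℕ → ℝ), ∀ (ν : ℕ → (j : ℕ) → MeasureTheory.Measure (GaugeField (F.P j) 0 ↥(Matrix.specialUnitaryGroup (Fin 2) ℂ))), (∀ K, ν K K = T4GenFunBounds.gibbsMeasure (F.P K) ((F.scheme ℰp γ).β K)) → (∀ K j, j < K → ν K j = Measure.map (descend F ℰp j) (ν K (j + 1))) → ∀ (K K' : ℕ), K ≤ K' → ∀ (Ts T : ℕ), Ts < T → T ≤ K → ∀ (μ μ' : ((j : ℕ) → MeasureTheory.Measure (GaugeField (F.P j) 0 ↥(Matrix.specialUnitaryGroup (Fin 2) ℂ)))) (ρ ρ' : ((j : ℕ) → GaugeField (F.P j) 0 ↥(Matrix.specialUnitaryGroup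 (Fin 2) ℂ) → ℝ)), (∀ j : ℕ, Ts ≤ j → j ≤ T → μ j = ν K j ∧ μ' j = ν K' j) → (∀ j : ℕ, j < Ts → μ j = Measure.map (descend F ℰp j) ((μ (j + 1)).withDensity (fun U => ENNReal.ofReal (sfCut (θBal F.L γ b₀ p₀ (j + 1)) U))) ∧ μ' j = Measure.map (descend F ℰp j) ((μ' (j + 1)).withDensity (fun U => ENNReal.ofReal (sfCut (θBal F.L γ b₀ p₀ (j + 1)) U)))) → (∀ j : ℕ, Ts ≤ j → j < T → μ j = Measure.map (descend F ℰp j) (μ (j + 1)) ∧ μ' j = Measure.map (descend F ℰp j) (μ' (j + 1))) → (∀ j : ℕ, j ≤ T → IsFiniteMeasure (μ j) ∧ IsFiniteMeasure (μ' j)) → (∀ j : ℕ, j₀ ≤ j → j ≤ T → ((∀ U, PlaqSmall (θBal F.L γ b₀ p₀ j) U → 0 < ρ j U ∧ 0 < ρ' j U) ∧ μ j = (fieldMeasure _ _ _).withDensity (fun U => ENNReal.ofReal (ρ j U)) ∧ μ' j = (fieldMeasure _ _ _).withDensity (fun U => ENNReal.ofReal (ρ' j U)) ∧ (∃ κ :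 ℝ, MemAtHeight F ℰp j (prm j) (fun U => Real.exp κ * ρ j U)) ∧ (∃ κ : ℝ, MemAtHeight F ℰp j (prm j) (fun U => Real.exp κ * ρ' j U)) ∧ μ j {U | ¬ PlaqSmall (θBal F.L γ b₀ p₀ j) U} ≤ ENNReal.ofReal (η j) ∧ μ' j {U | ¬ PlaqSmall (θBal F.L γ b₀ p₀ j) U} ≤ ENNReal.ofReal (η j) ∧ (ContinuousOn (ρ j) {U | PlaqSmall (θBal F.L γ b₀ p₀ j) U} ∧ ContinuousOn (ρ' j) {U | PlaqSmall (θBal F.L γ b₀ p₀ j) U}))) → ∀ (j : ℕ), jV ≤ j → j₀ ≤ j → j + 1 ≤ T → ∀ (σ : ProbabilityTheory.Kernel (GaugeField (F.P j) 0 ↥(Matrix.specialUnitaryGroup (Fin 2) ℂ)) (GaugeField (F.P (j + 1)) 0 ↥(Matrix.specialUnitaryGroup (Fin 2) ℂ))), ProbabilityTheory.IsMarkovKernel σ → (Measure.map (descend F ℰp j) (fieldMeasure (F.P (j + 1)) 0 ↥(Matrix.specialUnitaryGroup (Fin 2) ℂ))).bind ⇑σ = fieldMeasure (F.P (j + 1))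 0 ↥(Matrix.specialUnitaryGroup (Fin 2) ℂ) → (∀ᵐ V ∂(Measure.map (descend F ℰp j) (fieldMeasure (F.P (j + 1)) 0 ↥(Matrix.specialUnitaryGroup (Fin 2) ℂ))), ∀ᵐ U ∂(σ V), descend F ℰp j U = V) → ∃ (m : GaugeField (F.P j) 0 ↥(Matrix.specialUnitaryGroup (Fin 2) ℂ) → ℝ), ContinuousOn m {V | PlaqSmall (θBal F.L γ b₀ p₀ j) V} ∧ (∀ᵐ V ∂(fieldMeasure (F.P j) 0 ↥(Matrix.specialUnitaryGroup (Fin 2) ℂ)), PlaqSmall (θBal F.L γ b₀ p₀ j) V → MeasureTheory.Integrable (fun U => sfCut (θBal F.L γ b₀ p₀ (j + 1)) U * (Real.log (ρ (j + 1) U) - Real.log (ρ' (j + 1) U)) * ρ' (j + 1) U) (σ V) ∧ m V = (∫ U, sfCut (θBal F.L γ b₀ p₀ (j + 1)) U * (Real.log (ρ (j + 1) U) - Real.log (ρ' (j + 1) U)) * ρ' (j + 1) U ∂(σ V)) / (∫ U, sfCut (θBal F.L γ b₀ p₀ (j + 1)) U * ρ' (j + 1) U ∂(σ V)))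

/-- LIN∘ · tangent transport (g25-1 row 2, restated BY TEXT, byte-identical with `OrganTangent.TangentTransportCan`) — the row CUT by
this line: DERIVED below from MODE∘ ∧ TRM∘ ∧ LAP∘ (`tangentTransport_of_modeCut`), no stub here. -/
def TangentTransportCan : Prop :=
  ∃ γ₁ : ℝ, 0 < γ₁ ∧ ∀ (F : T3Family) (γ : ℝ), 0 < γ → γ ≤ γ₁ → ∀ (b₀ p₀ : ℝ) (j₀ : ℕ) (prm : ℕ → ClassParams) (η : ℕ → ℝ), 0 < b₀ → 0 < p₀ → AdmissibleClassParams F γ b₀ p₀ prm → (∀ j, 0 ≤ η j) → Summable η → Summable (fun i => ∑' k, η (k + i)) → Tendsto (fun j => (∑' k, η (k + j)) * ((1 + 2 * ((F.L : ℝ) ^ j / γ) * (Fintype.card (Plaq (F.P j) 0) : ℝ)) * (Fintype.card (PBond (F.P j) 0) : ℝ) ^ 2)) atTop (𝓝 0) → ∃ κ₀ : ℝ, 0 < κ₀ ∧ ∀ (κ : ℝ), 0 < κ → κ ≤ κ₀ → ∃ θ₀ : ℝ, 0 < θ₀ ∧ ∀ (θ : ℝ), 0 < θ → θ ≤ θ₀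 → ∃ (w₀ : ℝ) (ε εd δ : ℕ → ℝ) (j₁ : ℕ), 0 < w₀ ∧ (∀ j, 0 ≤ ε j ∧ 0 ≤ εd j ∧ 0 ≤ δ j) ∧ Summable ε ∧ Summable εd ∧ Summable δ ∧ Summable (fun i => ∑' k, δ (k + i)) ∧ Tendsto (fun j => (∑' k, δ (k + j)) * ((1 + 2 * ((F.L : ℝ) ^ j / γ) * (Fintype.card (Plaq (F.P j) 0) : ℝ)) * (Fintype.card (PBond (F.P j) 0) : ℝ) ^ 2)) atTop (𝓝 0) ∧ j₀ ≤ j₁ ∧ ∀ (ν : ℕ → (j : ℕ) → MeasureTheory.Measure (GaugeField (F.P j) 0 ↥(Matrix.specialUnitaryGroup (Fin 2) ℂ))), (∀ K, ν K K = T4GenFunBounds.gibbsMeasure (F.P K) ((F.scheme ℰp γ).β K)) → (∀ K j, j < K → ν K j = Measure.map (descend F ℰp j) (ν K (j + 1))) → ∀ (K K' : ℕ), K ≤ K' → ∀ (Ts T : ℕ), Ts < T → T ≤ K → ∀ (μ μ' : ((j : ℕ) → MeasureTheory.Measure (GaugeField (F.P j) 0 ↥(Matrix.specialUnitaryGroup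 (Fin 2) ℂ)))) (ρ ρ' : ((j : ℕ) → GaugeField (F.P j) 0 ↥(Matrix.specialUnitaryGroup (Fin 2) ℂ) → ℝ)), (∀ j : ℕ, Ts ≤ j → j ≤ T → μ j = ν K j ∧ μ' j = ν K' j) → (∀ j : ℕ, j < Ts → μ j = Measure.map (descend F ℰp j) ((μ (j + 1)).withDensity (fun U => ENNReal.ofReal (sfCut (θBal F.L γ b₀ p₀ (j + 1)) U))) ∧ μ' j = Measure.map (descend F ℰp j) ((μ' (j + 1)).withDensity (fun U => ENNReal.ofReal (sfCut (θBal F.L γ b₀ p₀ (j + 1)) U)))) → (∀ j : ℕ, Ts ≤ j → j < T → μ j = Measure.map (descend F ℰp j) (μ (j + 1)) ∧ μ' j = Measure.map (descend F ℰp j) (μ' (j + 1))) → (∀ j : ℕ, j ≤ T → IsFiniteMeasure (μ j) ∧ IsFiniteMeasure (μ' j)) → (∀ j : ℕ, j₀ ≤ j → j ≤ T → ((∀ U, PlaqSmall (θBal F.L γ b₀ p₀ j) U → 0 < ρ j U ∧ 0 < ρ' j U) ∧ μ j = (fieldMeasure _ _ _).withDensity (fun U => ENNReal.ofReal (ρ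 j U)) ∧ μ' j = (fieldMeasure _ _ _).withDensity (fun U => ENNReal.ofReal (ρ' j U)) ∧ (∃ κ : ℝ, MemAtHeight F ℰp j (prm j) (fun U => Real.exp κ * ρ j U)) ∧ (∃ κ : ℝ, MemAtHeight F ℰp j (prm j) (fun U => Real.exp κ * ρ' j U)) ∧ μ j {U | ¬ PlaqSmall (θBal F.L γ b₀ p₀ j) U} ≤ ENNReal.ofReal (η j) ∧ μ' j {U | ¬ PlaqSmall (θBal F.L γ b₀ p₀ j) U} ≤ ENNReal.ofReal (η j) ∧ (ContinuousOn (ρ j) {U | PlaqSmall (θBal F.L γ b₀ p₀ j) U} ∧ ContinuousOn (ρ' j) {U | PlaqSmall (θBal F.L γ b₀ p₀ j) U}))) → ∀ (j : ℕ), j₁ ≤ j → j + 2 ≤ T → j + 1 ≤ Ts → ∀ (σ : ProbabilityTheory.Kernel (GaugeField (F.P j) 0 ↥(Matrix.specialUnitaryGroup (Fin 2) ℂ)) (GaugeField (F.P (j + 1)) 0 ↥(Matrix.specialUnitaryGroup (Fin 2) ℂ))), ProbabilityTheory.IsMarkovKernel σ → (Measure.map (descend F ℰp j) (fieldMeasure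 (F.P (j + 1)) 0 ↥(Matrix.specialUnitaryGroup (Fin 2) ℂ))).bind ⇑σ = fieldMeasure (F.P (j + 1)) 0 ↥(Matrix.specialUnitaryGroup (Fin 2) ℂ) → (∀ᵐ V ∂(Measure.map (descend F ℰp j) (fieldMeasure (F.P (j + 1)) 0 ↥(Matrix.specialUnitaryGroup (Fin 2) ℂ))), ∀ᵐ U ∂(σ V), descend F ℰp j U = V) → ∀ (m : GaugeField (F.P j) 0 ↥(Matrix.specialUnitaryGroup (Fin 2) ℂ) → ℝ), ContinuousOn m {V | PlaqSmall (θBal F.L γ b₀ p₀ j) V} → (∀ᵐ V ∂(fieldMeasure (F.P j) 0 ↥(Matrix.specialUnitaryGroup (Fin 2) ℂ)), PlaqSmall (θBal F.L γ b₀ p₀ j) V → MeasureTheory.Integrable (fun U => sfCut (θBal F.L γ b₀ p₀ (j + 1)) U * (Real.log (ρ (j + 1) U) - Real.log (ρ' (j + 1) U)) * ρ' (j + 1) U) (σ V) ∧ m V = (∫ U, sfCut (θBal F.L γ b₀ p₀ (j + 1)) U * (Real.log (ρ (j + 1) U) - Real.log (ρ' (j + 1) U)) * ρ' (j + 1) U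 ∂(σ V)) / (∫ U, sfCut (θBal F.L γ b₀ p₀ (j + 1)) U * ρ' (j + 1) U ∂(σ V))) → ∀ (c : Plaq (F.P (j + 1)) 0 → ℝ) (a w : ℝ), 0 ≤ a → 0 ≤ w → a + θ / (((F.L : ℝ) ^ (j + 1) / γ) * θBal F.L γ b₀ p₀ (j + 1) ^ 2) * w ≤ w₀ → ((∀ p, |c p| ≤ a) ∧ (∀ (b b' : PBond (F.P (j + 1)) 0) U V W Z, PlaqSmall (θBal F.L γ b₀ p₀ (j + 1)) U → PlaqSmall (θBal F.L γ b₀ p₀ (j + 1)) V → PlaqSmall (θBal F.L γ b₀ p₀ (j + 1)) W → PlaqSmall (θBal F.L γ b₀ p₀ (j + 1)) Z → (∀ e, e ≠ b → U e = V e) → (∀ e, e ≠ b' → U e = W e) → (∀ e, e ≠ b' → V e = Z e) → (∀ e, e ≠ b → W e = Z e) → |(Real.log (ρ (j + 1) U) - Real.log (ρ' (j + 1) U) - ((F.L : ℝ) ^ (j + 1) / γ) * ∑ p, c p * (1 - reTr (GaugeField.plaqHol U p))) - (Real.log (ρ (j + 1) V) - Real.log (ρ' (j + 1) V) - ((F.L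 : ℝ) ^ (j + 1) / γ) * ∑ p, c p * (1 - reTr (GaugeField.plaqHol V p))) - ((Real.log (ρ (j + 1) W) - Real.log (ρ' (j + 1) W) - ((F.L : ℝ) ^ (j + 1) / γ) * ∑ p, c p * (1 - reTr (GaugeField.plaqHol W p))) - (Real.log (ρ (j + 1) Z) - Real.log (ρ' (j + 1) Z) - ((F.L : ℝ) ^ (j + 1) / γ) * ∑ p, c p * (1 - reTr (GaugeField.plaqHol Z p))))| ≤ w * Real.exp (-(κ * (b.src.tdist b'.src : ℝ))))) → ∃ (c' : Plaq (F.P j) 0 → ℝ) (a' w' : ℝ), 0 ≤ a' ∧ 0 ≤ w' ∧ a' + θ / (((F.L : ℝ) ^ j / γ) * θBal F.L γ b₀ p₀ j ^ 2) * w' ≤ (1 + ε j + εd (T - (j + 2))) * (a + θ / (((F.L : ℝ) ^ (j + 1) / γ) * θBal F.L γ b₀ p₀ (j + 1) ^ 2) * w) + δ j ∧ ((∀ p, |c' p| ≤ a') ∧ (∀ (b b' : PBond (F.P j) 0) U V W Z, PlaqSmall (θBal F.L γ b₀ p₀ j) U → PlaqSmall (θBal F.L γ b₀ p₀ j) V →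 PlaqSmall (θBal F.L γ b₀ p₀ j) W → PlaqSmall (θBal F.L γ b₀ p₀ j) Z → (∀ e, e ≠ b → U e = V e) → (∀ e, e ≠ b' → U e = W e) → (∀ e, e ≠ b' → V e = Z e) → (∀ e, e ≠ b → W e = Z e) → |(m U - ((F.L : ℝ) ^ j / γ) * ∑ p, c' p * (1 - reTr (GaugeField.plaqHol U p))) - (m V - ((F.L : ℝ) ^ j / γ) * ∑ p, c' p * (1 - reTr (GaugeField.plaqHol V p))) - ((m W - ((F.L : ℝ) ^ j / γ) * ∑ p, c' p * (1 - reTr (GaugeField.plaqHol W p))) - (m Z - ((F.L : ℝ) ^ j / γ) * ∑ p, c' p * (1 - reTr (GaugeField.plaqHol Z p))))| ≤ w' * Real.exp (-(κ * (b.src.tdist b'.src : ℝ)))))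

/-- JEN∘ · Jensen gap (g25-1 row 3, restated BY TEXT, byte-identical with `OrganTangent.JensenGapCan`; stub in organ_tangent.lean). -/
def JensenGapCan : Prop :=
  ∃ γ₁ : ℝ, 0 < γ₁ ∧ ∀ (F : T3Family) (γ : ℝ), 0 < γ → γ ≤ γ₁ → ∀ (b₀ p₀ : ℝ) (j₀ : ℕ) (prm : ℕ → ClassParams) (η : ℕ → ℝ), 0 < b₀ → 0 < p₀ → AdmissibleClassParams F γ b₀ p₀ prm → (∀ j, 0 ≤ η j) → Summable η → Summable (fun i => ∑' k, η (k + i)) → Tendsto (fun j => (∑' k, η (k + j)) * ((1 + 2 * ((F.L : ℝ) ^ j / γ) * (Fintype.card (Plaq (F.P j) 0) : ℝ)) * (Fintype.card (PBond (F.P j) 0) : ℝ) ^ 2)) atTop (𝓝 0) → ∃ κ₀ : ℝ, 0 < κ₀ ∧ ∀ (κ : ℝ), 0 < κ → κ ≤ κ₀ → ∃ θ₀ : ℝ, 0 < θ₀ ∧ ∀ (θ : ℝ), 0 < θ → θ ≤ θ₀ → ∃ (C w₀ : ℝ) (δ : ℕ → ℝ) (j₁ : ℕ), 0 ≤ C ∧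 0 < w₀ ∧ (∀ j, 0 ≤ δ j) ∧ Summable δ ∧ Summable (fun i => ∑' k, δ (k + i)) ∧ Tendsto (fun j => (∑' k, δ (k + j)) * ((1 + 2 * ((F.L : ℝ) ^ j / γ) * (Fintype.card (Plaq (F.P j) 0) : ℝ)) * (Fintype.card (PBond (F.P j) 0) : ℝ) ^ 2)) atTop (𝓝 0) ∧ j₀ ≤ j₁ ∧ ∀ (ν : ℕ → (j : ℕ) → MeasureTheory.Measure (GaugeField (F.P j) 0 ↥(Matrix.specialUnitaryGroup (Fin 2) ℂ))), (∀ K, ν K K = T4GenFunBounds.gibbsMeasure (F.P K) ((F.scheme ℰp γ).β K)) → (∀ K j, j < K → ν K j = Measure.map (descend F ℰp j) (ν K (j + 1))) → ∀ (K K' : ℕ), K ≤ K' → ∀ (Ts T : ℕ), Ts < T → T ≤ K → ∀ (μ μ' : ((j : ℕ) → MeasureTheory.Measure (GaugeField (F.P j) 0 ↥(Matrix.specialUnitaryGroup (Fin 2) ℂ)))) (ρ ρ' : ((j : ℕ) → GaugeField (F.P j) 0 ↥(Matrix.specialUnitaryGroup (Fin 2) ℂ) → ℝ)), (∀ j : ℕ,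 Ts ≤ j → j ≤ T → μ j = ν K j ∧ μ' j = ν K' j) → (∀ j : ℕ, j < Ts → μ j = Measure.map (descend F ℰp j) ((μ (j + 1)).withDensity (fun U => ENNReal.ofReal (sfCut (θBal F.L γ b₀ p₀ (j + 1)) U))) ∧ μ' j = Measure.map (descend F ℰp j) ((μ' (j + 1)).withDensity (fun U => ENNReal.ofReal (sfCut (θBal F.L γ b₀ p₀ (j + 1)) U)))) → (∀ j : ℕ, Ts ≤ j → j < T → μ j = Measure.map (descend F ℰp j) (μ (j + 1)) ∧ μ' j = Measure.map (descend F ℰp j) (μ' (j + 1))) → (∀ j : ℕ, j ≤ T → IsFiniteMeasure (μ j) ∧ IsFiniteMeasure (μ' j)) → (∀ j : ℕ, j₀ ≤ j → j ≤ T → ((∀ U, PlaqSmall (θBal F.L γ b₀ p₀ j) U → 0 < ρ j U ∧ 0 < ρ' j U) ∧ μ j = (fieldMeasure _ _ _).withDensity (fun U => ENNReal.ofReal (ρ j U)) ∧ μ' j = (fieldMeasure _ _ _).withDensity (fun U => ENNReal.ofReal (ρ' j U)) ∧ (∃ κ : ℝ, MemAtHeight F ℰp j (prm j) (fun U => Real.exp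 κ * ρ j U)) ∧ (∃ κ : ℝ, MemAtHeight F ℰp j (prm j) (fun U => Real.exp κ * ρ' j U)) ∧ μ j {U | ¬ PlaqSmall (θBal F.L γ b₀ p₀ j) U} ≤ ENNReal.ofReal (η j) ∧ μ' j {U | ¬ PlaqSmall (θBal F.L γ b₀ p₀ j) U} ≤ ENNReal.ofReal (η j) ∧ (ContinuousOn (ρ j) {U | PlaqSmall (θBal F.L γ b₀ p₀ j) U} ∧ ContinuousOn (ρ' j) {U | PlaqSmall (θBal F.L γ b₀ p₀ j) U}))) → ∀ (j : ℕ), j₁ ≤ j → j + 2 ≤ T → j + 1 ≤ Ts → ∀ (σ : ProbabilityTheory.Kernel (GaugeField (F.P j) 0 ↥(Matrix.specialUnitaryGroup (Fin 2) ℂ)) (GaugeField (F.P (j + 1)) 0 ↥(Matrix.specialUnitaryGroup (Fin 2) ℂ))), ProbabilityTheory.IsMarkovKernel σ → (Measure.map (descend F ℰp j) (fieldMeasure (F.P (j + 1)) 0 ↥(Matrix.specialUnitaryGroup (Fin 2) ℂ))).bind ⇑σ = fieldMeasure (F.P (j + 1)) 0 ↥(Matrix.specialUnitaryGroup (Fin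 2) ℂ) → (∀ᵐ V ∂(Measure.map (descend F ℰp j) (fieldMeasure (F.P (j + 1)) 0 ↥(Matrix.specialUnitaryGroup (Fin 2) ℂ))), ∀ᵐ U ∂(σ V), descend F ℰp j U = V) → ∀ (m : GaugeField (F.P j) 0 ↥(Matrix.specialUnitaryGroup (Fin 2) ℂ) → ℝ), ContinuousOn m {V | PlaqSmall (θBal F.L γ b₀ p₀ j) V} → (∀ᵐ V ∂(fieldMeasure (F.P j) 0 ↥(Matrix.specialUnitaryGroup (Fin 2) ℂ)), PlaqSmall (θBal F.L γ b₀ p₀ j) V → MeasureTheory.Integrable (fun U => sfCut (θBal F.L γ b₀ p₀ (j + 1)) U * (Real.log (ρ (j + 1) U) - Real.log (ρ' (j + 1) U)) * ρ' (j + 1) U) (σ V) ∧ m V = (∫ U, sfCut (θBal F.L γ b₀ p₀ (j + 1)) U * (Real.log (ρ (j + 1) U) - Real.log (ρ' (j + 1) U)) * ρ' (j + 1) U ∂(σ V)) / (∫ U, sfCut (θBal F.L γ b₀ p₀ (j + 1)) U * ρ' (j + 1) U ∂(σ V))) → ∀ (c : Plaq (F.P (j + 1)) 0 → ℝ) (a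 w : ℝ), 0 ≤ a → 0 ≤ w → a + θ / (((F.L : ℝ) ^ (j + 1) / γ) * θBal F.L γ b₀ p₀ (j + 1) ^ 2) * w ≤ w₀ → ((∀ p, |c p| ≤ a) ∧ (∀ (b b' : PBond (F.P (j + 1)) 0) U V W Z, PlaqSmall (θBal F.L γ b₀ p₀ (j + 1)) U → PlaqSmall (θBal F.L γ b₀ p₀ (j + 1)) V → PlaqSmall (θBal F.L γ b₀ p₀ (j + 1)) W → PlaqSmall (θBal F.L γ b₀ p₀ (j + 1)) Z → (∀ e, e ≠ b → U e = V e) → (∀ e, e ≠ b' → U e = W e) → (∀ e, e ≠ b' → V e = Z e) → (∀ e, e ≠ b → W e = Z e) → |(Real.log (ρ (j + 1) U) - Real.log (ρ' (j + 1) U) - ((F.L : ℝ) ^ (j + 1) / γ) * ∑ p, c p * (1 - reTr (GaugeField.plaqHol U p))) - (Real.log (ρ (j + 1) V) - Real.log (ρ' (j + 1) V) - ((F.L : ℝ) ^ (j + 1) / γ) * ∑ p, c p * (1 - reTr (GaugeField.plaqHol V p))) - ((Real.log (ρ (j + 1) W) - Real.log (ρ' (j + 1) W) - ((F.L : ℝ)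 ^ (j + 1) / γ) * ∑ p, c p * (1 - reTr (GaugeField.plaqHol W p))) - (Real.log (ρ (j + 1) Z) - Real.log (ρ' (j + 1) Z) - ((F.L : ℝ) ^ (j + 1) / γ) * ∑ p, c p * (1 - reTr (GaugeField.plaqHol Z p))))| ≤ w * Real.exp (-(κ * (b.src.tdist b'.src : ℝ))))) → ∃ (w' : ℝ), 0 ≤ w' ∧ θ / (((F.L : ℝ) ^ j / γ) * θBal F.L γ b₀ p₀ j ^ 2) * w' ≤ C * (a + θ / (((F.L : ℝ) ^ (j + 1) / γ) * θBal F.L γ b₀ p₀ (j + 1) ^ 2) * w) * (a + θ / (((F.L : ℝ) ^ (j + 1) / γ) * θBal F.L γ b₀ p₀ (j + 1) ^ 2) * w) + δ j ∧ (∀ (b b' : PBond (F.P j) 0) U V W Z, PlaqSmall (θBal F.L γ b₀ p₀ j) U → PlaqSmall (θBal F.L γ b₀ p₀ j) V → PlaqSmall (θBal F.L γ b₀ p₀ j) W → PlaqSmall (θBal F.L γ b₀ p₀ j) Z → (∀ e, e ≠ b → U e = V e) → (∀ e, e ≠ b' → U e = W e) → (∀ e, e ≠ b' → V e = Z e) →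 (∀ e, e ≠ b → W e = Z e) → |(Real.log (ρ j U) - Real.log (ρ' j U) - m U) - (Real.log (ρ j V) - Real.log (ρ' j V) - m V) - ((Real.log (ρ j W) - Real.log (ρ' j W) - m W) - (Real.log (ρ j Z) - Real.log (ρ' j Z) - m Z))| ≤ w' * Real.exp (-(κ * (b.src.tdist b'.src : ℝ))))

/-- MODE∘ · A CONTINUOUS FIBRE-MODE SECTION OF THE REFERENCE TOWER (row 1 of this line; size M–L, variational + implicit function; replaces
g25-2's MIN∘ and, unlike it, lives INSIDE O1's frame because it speaks of `ρ′`).  With O1's parameters and tower block (anchored ∕ SF-cut towers,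
window positivity ∕ continuity ∕ density clauses), from some height `j₁ ≥ j₀` on, for every organ height `j` (`j₁ ≤ j`, `j + 2 ≤ T`, `j + 1 ≤ Ts`):
there is `U_m : T_j → T_{j+1}`, continuous on the coarse window `{PlaqSmall θBal_j}`, with, for every window datum `V`: `descend (U_m V) = V`,
`U_m V` in the HALF fine window `{PlaqSmall θBal_{j+1}/2}` (so the cut `sfCut θBal_{j+1}` is `1` at and near it), and
`ρ′_{j+1}(U) ≤ ρ′_{j+1}(U_m V)` for every fine-window `U` over `V` (a GLOBAL fibre-mode over the open fine window).  Mechanism: over a window datum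
the reference density is `ρ′_{j+1} ∝ exp(−β_{K′}·A_{n′} + q′)` with `A_{n′}` the reference run's `n′ = K′−j−1`-step tree action — strictly convex
along the fibre transversally to the residual gauge orbits on the small-field set ([Balaban1985Propagators] (1.33): positivity of the
fluctuation operator) — and `q′` the class-controlled quantum part with `β`-free fibre derivatives; the mode is the `n′`-step background of
[Balaban1985Variational] Thm 1 ∕ (8)–(10) (fine plaquettes `O(θBal_j/L²) < θBal_{j+1}/2`) shifted by `O(g_{j+1}²)` (implicit function theorem at
the non-degenerate tree minimum in block-axial gauge), and Bałaban's covariant construction makes it a continuous FUNCTION of `V` (no selection: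
fibre and density are invariant under residual gauge transformations, so modes come in orbits and `U_m` is the axial-gauge representative, as
MIN∘ v2's `U⋆`); below the seed (`j + 1 < Ts`) the tower is the SF-cut run, whose density differs by earlier cut factors `= 1` on the deep window —
same mode.  Why it might fail: GLOBAL maximality over fibre ∩ fine window is claimed, not local — a second well of `−β′A_{n′} + q′` inside the
window over some datum breaks it; excluded iff the tree fibre-convexity constant `c·β_{j+1}/L²` dominates `sup_window |∇²_fibre q′|`, i.e. only
from a height `j₁(L, class)` on (hence the `∃ j₁`); continuity across data where the maximising orbit bifurcates would fail (uniqueness modulo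
residual gauge is part of the bet); the mode could sit in the collar `[θ/2, θ)` for data near the coarse window's edge (spreading constant vs
`L^{3/2}`, as MIN∘).  Sources: [Balaban1985Variational] Thm 1, (8)–(10) p.279, Prop. 9; [Balaban1985Propagators] (1.33); [Balaban1988RG2] §1
((0.3)–(0.12): form of the densities); tree `T3ConstrainedMinimiser.minAction`, `T3MinimiserStabilityReduction.HasMinimisersAt`. -/
def ModeSectionCan : Prop :=
  ∀ (F : T3Family) (γ : ℝ), 0 < γ → γ ≤ 1 → ∀ (b₀ p₀ : ℝ) (j₀ : ℕ) (prm : ℕ → ClassParams) (η : ℕ → ℝ), 0 < b₀ → 0 < p₀ → AdmissibleClassParams F γ b₀ p₀ prm → (∀ j, 0 ≤ η j) → Summable η → Summable (fun i => ∑' k, η (k + i)) → Tendsto (fun j => (∑' k, η (k + j)) * ((1 + 2 * ((F.L : ℝ) ^ j / γ) * (Fintype.card (Plaq (F.P j) 0) : ℝ)) * (Fintype.card (PBond (F.P j) 0) : ℝ) ^ 2)) atTop (𝓝 0) → ∃ j₁ : ℕ, j₀ ≤ j₁ ∧ ∀ (ν : ℕ → (j : ℕ) → MeasureTheory.Measure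 (GaugeField (F.P j) 0 ↥(Matrix.specialUnitaryGroup (Fin 2) ℂ))), (∀ K, ν K K = T4GenFunBounds.gibbsMeasure (F.P K) ((F.scheme ℰp γ).β K)) → (∀ K j, j < K → ν K j = Measure.map (descend F ℰp j) (ν K (j + 1))) → ∀ (K K' : ℕ), K ≤ K' → ∀ (Ts T : ℕ), Ts < T → T ≤ K → ∀ (μ μ' : ((j : ℕ) → MeasureTheory.Measure (GaugeField (F.P j) 0 ↥(Matrix.specialUnitaryGroup (Fin 2) ℂ)))) (ρ ρ' : ((j : ℕ) → GaugeField (F.P j) 0 ↥(Matrix.specialUnitaryGroup (Fin 2) ℂ) → ℝ)), (∀ j : ℕ, Ts ≤ j → j ≤ T → μ j = ν K j ∧ μ' j = ν K' j) → (∀ j : ℕ, j < Ts → μ j = Measure.map (descend F ℰp j) ((μ (j + 1)).withDensity (fun U => ENNReal.ofReal (sfCut (θBal F.L γ b₀ p₀ (j + 1)) U))) ∧ μ' j = Measure.map (descend F ℰp j) ((μ' (j + 1)).withDensity (fun U => ENNReal.ofReal (sfCut (θBal F.L γ b₀ p₀ (j + 1)) U)))) → (∀ j : ℕ, Ts ≤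 j → j < T → μ j = Measure.map (descend F ℰp j) (μ (j + 1)) ∧ μ' j = Measure.map (descend F ℰp j) (μ' (j + 1))) → (∀ j : ℕ, j ≤ T → IsFiniteMeasure (μ j) ∧ IsFiniteMeasure (μ' j)) → (∀ j : ℕ, j₀ ≤ j → j ≤ T → ((∀ U, PlaqSmall (θBal F.L γ b₀ p₀ j) U → 0 < ρ j U ∧ 0 < ρ' j U) ∧ μ j = (fieldMeasure _ _ _).withDensity (fun U => ENNReal.ofReal (ρ j U)) ∧ μ' j = (fieldMeasure _ _ _).withDensity (fun U => ENNReal.ofReal (ρ' j U)) ∧ (∃ κ : ℝ, MemAtHeight F ℰp j (prm j) (fun U => Real.exp κ * ρ j U)) ∧ (∃ κ : ℝ, MemAtHeight F ℰp j (prm j) (fun U => Real.exp κ * ρ' j U)) ∧ μ j {U | ¬ PlaqSmall (θBal F.L γ b₀ p₀ j) U} ≤ ENNReal.ofReal (η j) ∧ μ' j {U | ¬ PlaqSmall (θBal F.L γ b₀ p₀ j) U} ≤ ENNReal.ofReal (η j) ∧ (ContinuousOn (ρ j) {U | PlaqSmall (θBal F.L γ b₀ p₀ j) U} ∧ ContinuousOn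 (ρ' j) {U | PlaqSmall (θBal F.L γ b₀ p₀ j) U}))) → ∀ (j : ℕ), j₁ ≤ j → j + 2 ≤ T → j + 1 ≤ Ts → ∃ (Us : GaugeField (F.P j) 0 ↥(Matrix.specialUnitaryGroup (Fin 2) ℂ) → GaugeField (F.P (j + 1)) 0 ↥(Matrix.specialUnitaryGroup (Fin 2) ℂ)), ContinuousOn Us {V | PlaqSmall (θBal F.L γ b₀ p₀ j) V} ∧ (∀ V, PlaqSmall (θBal F.L γ b₀ p₀ j) V → descend F ℰp j (Us V) = V ∧ PlaqSmall (θBal F.L γ b₀ p₀ (j + 1) / 2) (Us V) ∧ ∀ U, descend F ℰp j U = V → PlaqSmall (θBal F.L γ b₀ p₀ (j + 1)) U → ρ' (j + 1) U ≤ ρ' (j + 1) (Us V))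

/-- TRM∘ · TRANSPORT THROUGH THE MODE SECTION (row 2 of this line; size L — the HARDEST; = the TEXT of g25-2's BGEV∘ with MIN∘'s section
property replaced by MODE∘'s, everything else byte-identical: LIN∘'s frame, «∀ θ ∈ (0, θ₀]» head, profiles `ε` (classical anharmonic +
one-loop), `εd` (equilibration defect in the depth `n = T − (j+2)`), floor `δ` of O1's class, smallness `w₀`, `κ ∈ (0, κ₀]`).  For EVERY
continuous fibre-mode section `U_m` and every input presentation `(c, a, w)` of `h = log ρ_{j+1} − log ρ′_{j+1}` with `x ≤ w₀`: `V ↦ h(U_m V)` has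
a coarse presentation `(c⋆, a⋆, w⋆)`, `|c⋆| ≤ a⋆`, with `a⋆ + Θ_j w⋆ ≤ (1 + ε_j + εd_n)·x + δ_j` and the 4-point clause at height `j`.  Mechanism:
as BGEV∘ (marginal channel: block-averaged coefficients `|c⋆| ≤ a` + spreading; remainder channel: pull-back of the fine 4-point clause along the
section's exponentially localised one-bond response), but through the centre the reference fibre law actually has.  `U_m` = the reference run's
`n′`-step background `+ O(g²)`, so (a) the reference run's own tree action is transported EXACTLY (composition of constrained minima,
[Balaban1985Variational] (8): `min_{U ↦ V} A_{n′}(U) = A_{n′+1}(V)`), (b) the equilibration picture behind `εd_n` (FP recursion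
`Q_{n+1} = M_{Q_n}ᵀQ_nM_{Q_n}`, arXiv:hep-lat/9506030 §3–§4) is LITERALLY the transport through `U_m` (P26-1: not through the Wilson section),
(c) the response decay of `U_m` is that of Bałaban's `k`-step backgrounds, uniform in `k` ([Balaban1985Variational] Prop. 9), perturbed by
`O(g²)`.  Why it might fail: (i) THE KT-W BET exactly as BGEV∘ (i) — a Wilson-exact, un-equilibrated input spreads by `κ_geom·θ` through ANY
section; the bet is that the anchored towers' discrepancy at depth `n` is equilibrated so that the net defect is `εd_n`, `Σ εd_n < ∞`
(instruments F2 ∕ FL-17); (ii) the remainder pull-back norm `N(κ) ≤ 1 + ε_j` (FL-17 (2b)), now for the `k`-step background's response kernel —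
`k`-uniform decay is printed, the constant `1` is not; (iii) `U_m` is not a classical object: its `O(g²)` displacement from the tree background
must itself be 4-point-clustered in `V` (a smooth quasi-local functional of `V` if `q′` is — class-level input).  Sources: BGEV∘'s
([Balaban1985Variational] Thm 1, Prop. 9; [Balaban1987RG1] (0.22)–(0.30), Thm 1; arXiv:hep-lat/9506030 §3–§4; doi:10.1016/0550-3213(94)90261-5). -/
def ModeTransportCan : Prop :=
  ∃ γ₁ : ℝ, 0 < γ₁ ∧ ∀ (F : T3Family) (γ : ℝ), 0 < γ → γ ≤ γ₁ → ∀ (b₀ p₀ : ℝ) (j₀ : ℕ) (prm : ℕ → ClassParams) (η : ℕ → ℝ), 0 < b₀ → 0 < p₀ → AdmissibleClassParams F γ b₀ p₀ prm → (∀ j, 0 ≤ η j) → Summable η → Summable (fun i => ∑' k, η (k + i)) → Tendsto (fun j => (∑' k, η (k + j)) * ((1 + 2 * ((F.L : ℝ) ^ j / γ) * (Fintype.card (Plaq (F.P j) 0) : ℝ)) * (Fintype.card (PBond (F.P j) 0) : ℝ) ^ 2)) atTop (𝓝 0) → ∃ κ₀ : ℝ, 0 < κ₀ ∧ ∀ (κ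 : ℝ), 0 < κ → κ ≤ κ₀ → ∃ θ₀ : ℝ, 0 < θ₀ ∧ ∀ (θ : ℝ), 0 < θ → θ ≤ θ₀ → ∃ (w₀ : ℝ) (ε εd δ : ℕ → ℝ) (j₁ : ℕ), 0 < w₀ ∧ (∀ j, 0 ≤ ε j ∧ 0 ≤ εd j ∧ 0 ≤ δ j) ∧ Summable ε ∧ Summable εd ∧ Summable δ ∧ Summable (fun i => ∑' k, δ (k + i)) ∧ Tendsto (fun j => (∑' k, δ (k + j)) * ((1 + 2 * ((F.L : ℝ) ^ j / γ) * (Fintype.card (Plaq (F.P j) 0) : ℝ)) * (Fintype.card (PBond (F.P j) 0) : ℝ) ^ 2)) atTop (𝓝 0) ∧ j₀ ≤ j₁ ∧ ∀ (ν : ℕ → (j : ℕ) → MeasureTheory.Measure (GaugeField (F.P j) 0 ↥(Matrix.specialUnitaryGroup (Fin 2) ℂ))), (∀ K, ν K K = T4GenFunBounds.gibbsMeasure (F.P K) ((F.scheme ℰp γ).β K)) → (∀ K j, j < K → ν K j = Measure.map (descend F ℰp j) (ν K (j + 1))) → ∀ (K K' : ℕ), K ≤ K' → ∀ (Ts T :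 ℕ), Ts < T → T ≤ K → ∀ (μ μ' : ((j : ℕ) → MeasureTheory.Measure (GaugeField (F.P j) 0 ↥(Matrix.specialUnitaryGroup (Fin 2) ℂ)))) (ρ ρ' : ((j : ℕ) → GaugeField (F.P j) 0 ↥(Matrix.specialUnitaryGroup (Fin 2) ℂ) → ℝ)), (∀ j : ℕ, Ts ≤ j → j ≤ T → μ j = ν K j ∧ μ' j = ν K' j) → (∀ j : ℕ, j < Ts → μ j = Measure.map (descend F ℰp j) ((μ (j + 1)).withDensity (fun U => ENNReal.ofReal (sfCut (θBal F.L γ b₀ p₀ (j + 1)) U))) ∧ μ' j = Measure.map (descend F ℰp j) ((μ' (j + 1)).withDensity (fun U => ENNReal.ofReal (sfCut (θBal F.L γ b₀ p₀ (j + 1)) U)))) → (∀ j : ℕ, Ts ≤ j → j < T → μ j = Measure.map (descend F ℰp j) (μ (j + 1)) ∧ μ' j = Measure.map (descend F ℰp j) (μ' (j + 1))) → (∀ j : ℕ, j ≤ T → IsFiniteMeasure (μ j) ∧ IsFiniteMeasure (μ' j)) → (∀ j : ℕ, j₀ ≤ j → j ≤ T → ((∀ U, PlaqSmall (θBal F.L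 γ b₀ p₀ j) U → 0 < ρ j U ∧ 0 < ρ' j U) ∧ μ j = (fieldMeasure _ _ _).withDensity (fun U => ENNReal.ofReal (ρ j U)) ∧ μ' j = (fieldMeasure _ _ _).withDensity (fun U => ENNReal.ofReal (ρ' j U)) ∧ (∃ κ : ℝ, MemAtHeight F ℰp j (prm j) (fun U => Real.exp κ * ρ j U)) ∧ (∃ κ : ℝ, MemAtHeight F ℰp j (prm j) (fun U => Real.exp κ * ρ' j U)) ∧ μ j {U | ¬ PlaqSmall (θBal F.L γ b₀ p₀ j) U} ≤ ENNReal.ofReal (η j) ∧ μ' j {U | ¬ PlaqSmall (θBal F.L γ b₀ p₀ j) U} ≤ ENNReal.ofReal (η j) ∧ (ContinuousOn (ρ j) {U | PlaqSmall (θBal F.L γ b₀ p₀ j) U} ∧ ContinuousOn (ρ' j) {U | PlaqSmall (θBal F.L γ b₀ p₀ j) U}))) → ∀ (j : ℕ), j₁ ≤ j → j + 2 ≤ T → j + 1 ≤ Ts → ∀ (Us : GaugeField (F.P j) 0 ↥(Matrix.specialUnitaryGroup (Fin 2) ℂ) → GaugeField (F.P (j + 1)) 0 ↥(Matrix.specialUnitaryGroup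 (Fin 2) ℂ)), ContinuousOn Us {V | PlaqSmall (θBal F.L γ b₀ p₀ j) V} → (∀ V, PlaqSmall (θBal F.L γ b₀ p₀ j) V → descend F ℰp j (Us V) = V ∧ PlaqSmall (θBal F.L γ b₀ p₀ (j + 1) / 2) (Us V) ∧ ∀ U, descend F ℰp j U = V → PlaqSmall (θBal F.L γ b₀ p₀ (j + 1)) U → ρ' (j + 1) U ≤ ρ' (j + 1) (Us V)) → ∀ (c : Plaq (F.P (j + 1)) 0 → ℝ) (a w : ℝ), 0 ≤ a → 0 ≤ w → a + θ / (((F.L : ℝ) ^ (j + 1) / γ) * θBal F.L γ b₀ p₀ (j + 1) ^ 2) * w ≤ w₀ → ((∀ p, |c p| ≤ a) ∧ (∀ (b b' : PBond (F.P (j + 1)) 0) U V W Z, PlaqSmall (θBal F.L γ b₀ p₀ (j + 1)) U → PlaqSmall (θBal F.L γ b₀ p₀ (j + 1)) V → PlaqSmall (θBal F.L γ b₀ p₀ (j + 1)) W → PlaqSmall (θBal F.L γ b₀ p₀ (j + 1)) Z → (∀ e, e ≠ b → U e = V e) → (∀ e, e ≠ b' → U e = W e) → (∀ e, e ≠ b'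 → V e = Z e) → (∀ e, e ≠ b → W e = Z e) → |(Real.log (ρ (j + 1) U) - Real.log (ρ' (j + 1) U) - ((F.L : ℝ) ^ (j + 1) / γ) * ∑ p, c p * (1 - reTr (GaugeField.plaqHol U p))) - (Real.log (ρ (j + 1) V) - Real.log (ρ' (j + 1) V) - ((F.L : ℝ) ^ (j + 1) / γ) * ∑ p, c p * (1 - reTr (GaugeField.plaqHol V p))) - ((Real.log (ρ (j + 1) W) - Real.log (ρ' (j + 1) W) - ((F.L : ℝ) ^ (j + 1) / γ) * ∑ p, c p * (1 - reTr (GaugeField.plaqHol W p))) - (Real.log (ρ (j + 1) Z) - Real.log (ρ' (j + 1) Z) - ((F.L : ℝ) ^ (j + 1) / γ) * ∑ p, c p * (1 - reTr (GaugeField.plaqHol Z p))))| ≤ w * Real.exp (-(κ * (b.src.tdist b'.src : ℝ))))) → ∃ (c' : Plaq (F.P j) 0 → ℝ) (a' w' : ℝ), 0 ≤ a' ∧ 0 ≤ w' ∧ a' + θ / (((F.L : ℝ) ^ j / γ) * θBal F.L γ b₀ p₀ j ^ 2) * w' ≤ (1 + ε j + εd (T - (j + 2))) * (a + θ / (((F.L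 : ℝ) ^ (j + 1) / γ) * θBal F.L γ b₀ p₀ (j + 1) ^ 2) * w) + δ j ∧ ((∀ p, |c' p| ≤ a') ∧ (∀ (b b' : PBond (F.P j) 0) U V W Z, PlaqSmall (θBal F.L γ b₀ p₀ j) U → PlaqSmall (θBal F.L γ b₀ p₀ j) V → PlaqSmall (θBal F.L γ b₀ p₀ j) W → PlaqSmall (θBal F.L γ b₀ p₀ j) Z → (∀ e, e ≠ b → U e = V e) → (∀ e, e ≠ b' → U e = W e) → (∀ e, e ≠ b' → V e = Z e) → (∀ e, e ≠ b → W e = Z e) → |(Real.log (ρ (j + 1) (Us U)) - Real.log (ρ' (j + 1) (Us U)) - ((F.L : ℝ) ^ j / γ) * ∑ p, c' p * (1 - reTr (GaugeField.plaqHol U p))) - (Real.log (ρ (j + 1) (Us V)) - Real.log (ρ' (j + 1) (Us V)) - ((F.L : ℝ) ^ j / γ) * ∑ p, c' p * (1 - reTr (GaugeField.plaqHol V p))) - ((Real.log (ρ (j + 1) (Us W)) - Real.log (ρ' (j + 1) (Us W)) - ((F.L : ℝ) ^ j / γ) * ∑ p, c' p * (1 - reTr (GaugeField.plaqHol W p)))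 - (Real.log (ρ (j + 1) (Us Z)) - Real.log (ρ' (j + 1) (Us Z)) - ((F.L : ℝ) ^ j / γ) * ∑ p, c' p * (1 - reTr (GaugeField.plaqHol Z p))))| ≤ w' * Real.exp (-(κ * (b.src.tdist b'.src : ℝ)))))

/-- LAP∘ · THE LAPLACE CORRECTION ABOUT THE MODE IS `ε`-SMALL (row 3 of this line; size L — one loop + cumulants on the cut fibre; = the TEXT
of g25-2's FLUC∘ with MIN∘'s section property replaced by MODE∘'s, everything else byte-identical: VER∘'s objects `σ` (a disintegration of
product Haar along `descend`) and `m` (a window-continuous version of the localised reference fibre mean `E′_χ[h | ·]`)).  For every continuous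
fibre-mode section `U_m`: `V ↦ m(V) − h(U_m V)` has a coarse presentation `(c″, a″, w″)`, `|c″| ≤ a″`, with `a″ + Θ_j w″ ≤ ε_j·x + δ_j` — NO
order-one multiple of `x`.  Mechanism: Laplace's method on the cut fibre law `χ·ρ′_{j+1} dσ_V` about ITS OWN maximiser `U_mV` (`χ = 1` there:
half window): `m(V) − h(U_mV) = ⟨∇h(U_mV), E′_χ[ζ | V]⟩ + ½ tr(G_V ∇²h(U_mV)) + …`, where `E′_χ[ζ | V]` — the mean displacement of the law FROM
ITS MODE — is `O(third cumulant × variance²) = O(g_{j+1}²)` in lattice units (for the Wilson-centred FLUC∘ it was the CLASSICAL displacement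
`δU = O(κ_geom)`: P26-1), so the first-order term is `O(ε_j)·x`; the second-order term is a `V`-independent constant for `h ∝ A_{j+1}` at one
loop and its `V`-dependence (`V`-dependence of `G_V`, [Balaban1985Propagators]; third cumulants) is `O(g_j²/θ)·a` on the marginal channel and
`O(1/(L³p(g_j)²))·Θ_{j+1}w` on clustered remainders; collar ∕ large fields go to the floor.  In the Gaussian model the whole difference is the
constant `tr(G D)`: zero 4-point content, `ε = 0`.  Why it might fail: as FLUC∘ — the class must control TWO fibre derivatives of
`log ρ′_{j+1}` on the small-field set for the cumulant bounds (Mem is inequality-level), and the remainder part of `ε_j` decays only like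
`1/p(g_j)² ∝ 1/j²`; new here: `∇h` is evaluated at the `O(g²)`-quantum-shifted mode, harmless at first order, but the clustering of `U_m` in `V` is
MODE∘'s ∕ TRM∘'s burden and enters the `V`-dependence of every term.  Sources: FLUC∘'s ([Balaban1987RG1] §2, Thm 1; [Balaban1988RG2] §1;
[Balaban1985Propagators]; [Balaban1989LargeFieldII] §1; arXiv:2307.07619 §3.4) + Laplace's method about an interior non-degenerate maximum. -/
def LaplaceCorrectionCan : Prop :=
  ∃ γ₁ : ℝ, 0 < γ₁ ∧ ∀ (F : T3Family) (γ : ℝ), 0 < γ → γ ≤ γ₁ → ∀ (b₀ p₀ : ℝ) (j₀ : ℕ) (prm : ℕ → ClassParams) (η : ℕ → ℝ), 0 < b₀ → 0 < p₀ → AdmissibleClassParams F γ b₀ p₀ prm → (∀ j, 0 ≤ η j) → Summable η → Summable (fun i => ∑' k, η (k + i)) → Tendsto (fun j => (∑' k, η (k + j)) * ((1 + 2 * ((F.L : ℝ) ^ j / γ) * (Fintype.card (Plaq (F.P j) 0) : ℝ)) * (Fintype.card (PBond (F.P j) 0) : ℝ) ^ 2)) atTop (𝓝 0) → ∃ κ₀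 : ℝ, 0 < κ₀ ∧ ∀ (κ : ℝ), 0 < κ → κ ≤ κ₀ → ∃ θ₀ : ℝ, 0 < θ₀ ∧ ∀ (θ : ℝ), 0 < θ → θ ≤ θ₀ → ∃ (w₀ : ℝ) (ε δ : ℕ → ℝ) (j₁ : ℕ), 0 < w₀ ∧ (∀ j, 0 ≤ ε j ∧ 0 ≤ δ j) ∧ Summable ε ∧ Summable δ ∧ Summable (fun i => ∑' k, δ (k + i)) ∧ Tendsto (fun j => (∑' k, δ (k + j)) * ((1 + 2 * ((F.L : ℝ) ^ j / γ) * (Fintype.card (Plaq (F.P j) 0) : ℝ)) * (Fintype.card (PBond (F.P j) 0) : ℝ) ^ 2)) atTop (𝓝 0) ∧ j₀ ≤ j₁ ∧ ∀ (ν : ℕ → (j : ℕ) → MeasureTheory.Measure (GaugeField (F.P j) 0 ↥(Matrix.specialUnitaryGroup (Fin 2) ℂ))), (∀ K, ν K K = T4GenFunBounds.gibbsMeasure (F.P K) ((F.scheme ℰp γ).β K)) → (∀ K j, j < K → ν K j = Measure.map (descend F ℰp j) (ν K (j + 1))) → ∀ (K K' : ℕ), K ≤ K' → ∀ (Ts T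 : ℕ), Ts < T → T ≤ K → ∀ (μ μ' : ((j : ℕ) → MeasureTheory.Measure (GaugeField (F.P j) 0 ↥(Matrix.specialUnitaryGroup (Fin 2) ℂ)))) (ρ ρ' : ((j : ℕ) → GaugeField (F.P j) 0 ↥(Matrix.specialUnitaryGroup (Fin 2) ℂ) → ℝ)), (∀ j : ℕ, Ts ≤ j → j ≤ T → μ j = ν K j ∧ μ' j = ν K' j) → (∀ j : ℕ, j < Ts → μ j = Measure.map (descend F ℰp j) ((μ (j + 1)).withDensity (fun U => ENNReal.ofReal (sfCut (θBal F.L γ b₀ p₀ (j + 1)) U))) ∧ μ' j = Measure.map (descend F ℰp j) ((μ' (j + 1)).withDensity (fun U => ENNReal.ofReal (sfCut (θBal F.L γ b₀ p₀ (j + 1)) U)))) → (∀ j : ℕ, Ts ≤ j → j < T → μ j = Measure.map (descend F ℰp j) (μ (j + 1)) ∧ μ' j = Measure.map (descend F ℰp j) (μ' (j + 1))) → (∀ j : ℕ, j ≤ T → IsFiniteMeasure (μ j) ∧ IsFiniteMeasure (μ' j)) → (∀ j : ℕ, j₀ ≤ j → j ≤ T → ((∀ U, PlaqSmall (θBal F.L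 γ b₀ p₀ j) U → 0 < ρ j U ∧ 0 < ρ' j U) ∧ μ j = (fieldMeasure _ _ _).withDensity (fun U => ENNReal.ofReal (ρ j U)) ∧ μ' j = (fieldMeasure _ _ _).withDensity (fun U => ENNReal.ofReal (ρ' j U)) ∧ (∃ κ : ℝ, MemAtHeight F ℰp j (prm j) (fun U => Real.exp κ * ρ j U)) ∧ (∃ κ : ℝ, MemAtHeight F ℰp j (prm j) (fun U => Real.exp κ * ρ' j U)) ∧ μ j {U | ¬ PlaqSmall (θBal F.L γ b₀ p₀ j) U} ≤ ENNReal.ofReal (η j) ∧ μ' j {U | ¬ PlaqSmall (θBal F.L γ b₀ p₀ j) U} ≤ ENNReal.ofReal (η j) ∧ (ContinuousOn (ρ j) {U | PlaqSmall (θBal F.L γ b₀ p₀ j) U} ∧ ContinuousOn (ρ' j) {U | PlaqSmall (θBal F.L γ b₀ p₀ j) U}))) → ∀ (j : ℕ), j₁ ≤ j → j + 2 ≤ T → j + 1 ≤ Ts → ∀ (σ : ProbabilityTheory.Kernel (GaugeField (F.P j) 0 ↥(Matrix.specialUnitaryGroup (Fin 2) ℂ)) (GaugeField (F.P (j + 1))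 0 ↥(Matrix.specialUnitaryGroup (Fin 2) ℂ))), ProbabilityTheory.IsMarkovKernel σ → (Measure.map (descend F ℰp j) (fieldMeasure (F.P (j + 1)) 0 ↥(Matrix.specialUnitaryGroup (Fin 2) ℂ))).bind ⇑σ = fieldMeasure (F.P (j + 1)) 0 ↥(Matrix.specialUnitaryGroup (Fin 2) ℂ) → (∀ᵐ V ∂(Measure.map (descend F ℰp j) (fieldMeasure (F.P (j + 1)) 0 ↥(Matrix.specialUnitaryGroup (Fin 2) ℂ))), ∀ᵐ U ∂(σ V), descend F ℰp j U = V) → ∀ (m : GaugeField (F.P j) 0 ↥(Matrix.specialUnitaryGroup (Fin 2) ℂ) → ℝ), ContinuousOn m {V | PlaqSmall (θBal F.L γ b₀ p₀ j) V} → (∀ᵐ V ∂(fieldMeasure (F.P j) 0 ↥(Matrix.specialUnitaryGroup (Fin 2) ℂ)), PlaqSmall (θBal F.L γ b₀ p₀ j) V → MeasureTheory.Integrable (fun U => sfCut (θBal F.L γ b₀ p₀ (j + 1)) U * (Real.log (ρ (j + 1) U) - Real.log (ρ' (j + 1) U)) * ρ' (j + 1) U) (σ V) ∧ m V = (∫ U,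 sfCut (θBal F.L γ b₀ p₀ (j + 1)) U * (Real.log (ρ (j + 1) U) - Real.log (ρ' (j + 1) U)) * ρ' (j + 1) U ∂(σ V)) / (∫ U, sfCut (θBal F.L γ b₀ p₀ (j + 1)) U * ρ' (j + 1) U ∂(σ V))) → ∀ (Us : GaugeField (F.P j) 0 ↥(Matrix.specialUnitaryGroup (Fin 2) ℂ) → GaugeField (F.P (j + 1)) 0 ↥(Matrix.specialUnitaryGroup (Fin 2) ℂ)), ContinuousOn Us {V | PlaqSmall (θBal F.L γ b₀ p₀ j) V} → (∀ V, PlaqSmall (θBal F.L γ b₀ p₀ j) V → descend F ℰp j (Us V) = V ∧ PlaqSmall (θBal F.L γ b₀ p₀ (j + 1) / 2) (Us V) ∧ ∀ U, descend F ℰp j U = V → PlaqSmall (θBal F.L γ b₀ p₀ (j + 1)) U → ρ' (j + 1) U ≤ ρ' (j + 1) (Us V)) → ∀ (c : Plaq (F.P (j + 1)) 0 → ℝ) (a w : ℝ), 0 ≤ a → 0 ≤ w → a + θ / (((F.L : ℝ) ^ (j + 1) / γ) * θBal F.L γ b₀ p₀ (j + 1) ^ 2) * w ≤ w₀ → ((∀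 p, |c p| ≤ a) ∧ (∀ (b b' : PBond (F.P (j + 1)) 0) U V W Z, PlaqSmall (θBal F.L γ b₀ p₀ (j + 1)) U → PlaqSmall (θBal F.L γ b₀ p₀ (j + 1)) V → PlaqSmall (θBal F.L γ b₀ p₀ (j + 1)) W → PlaqSmall (θBal F.L γ b₀ p₀ (j + 1)) Z → (∀ e, e ≠ b → U e = V e) → (∀ e, e ≠ b' → U e = W e) → (∀ e, e ≠ b' → V e = Z e) → (∀ e, e ≠ b → W e = Z e) → |(Real.log (ρ (j + 1) U) - Real.log (ρ' (j + 1) U) - ((F.L : ℝ) ^ (j + 1) / γ) * ∑ p, c p * (1 - reTr (GaugeField.plaqHol U p))) - (Real.log (ρ (j + 1) V) - Real.log (ρ' (j + 1) V) - ((F.L : ℝ) ^ (j + 1) / γ) * ∑ p, c p * (1 - reTr (GaugeField.plaqHol V p))) - ((Real.log (ρ (j + 1) W) - Real.log (ρ' (j + 1) W) - ((F.L : ℝ) ^ (j + 1) / γ) * ∑ p, c p * (1 - reTr (GaugeField.plaqHol W p))) - (Real.log (ρ (j + 1) Z) - Real.log (ρ' (j + 1) Z) - ((F.L : ℝ) ^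 (j + 1) / γ) * ∑ p, c p * (1 - reTr (GaugeField.plaqHol Z p))))| ≤ w * Real.exp (-(κ * (b.src.tdist b'.src : ℝ))))) → ∃ (c' : Plaq (F.P j) 0 → ℝ) (a' w' : ℝ), 0 ≤ a' ∧ 0 ≤ w' ∧ a' + θ / (((F.L : ℝ) ^ j / γ) * θBal F.L γ b₀ p₀ j ^ 2) * w' ≤ ε j * (a + θ / (((F.L : ℝ) ^ (j + 1) / γ) * θBal F.L γ b₀ p₀ (j + 1) ^ 2) * w) + δ j ∧ ((∀ p, |c' p| ≤ a') ∧ (∀ (b b' : PBond (F.P j) 0) U V W Z, PlaqSmall (θBal F.L γ b₀ p₀ j) U → PlaqSmall (θBal F.L γ b₀ p₀ j) V → PlaqSmall (θBal F.L γ b₀ p₀ j) W → PlaqSmall (θBal F.L γ b₀ p₀ j) Z → (∀ e, e ≠ b → U e = V e) → (∀ e, e ≠ b' → U e = W e) → (∀ e, e ≠ b' → V e = Z e) → (∀ e, e ≠ b → W e = Z e) → |(m U - (Real.log (ρ (j + 1) (Us U)) - Real.log (ρ' (j + 1) (Us U))) - ((F.L : ℝ) ^ j / γ) * ∑ p, c'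 p * (1 - reTr (GaugeField.plaqHol U p))) - (m V - (Real.log (ρ (j + 1) (Us V)) - Real.log (ρ' (j + 1) (Us V))) - ((F.L : ℝ) ^ j / γ) * ∑ p, c' p * (1 - reTr (GaugeField.plaqHol V p))) - ((m W - (Real.log (ρ (j + 1) (Us W)) - Real.log (ρ' (j + 1) (Us W))) - ((F.L : ℝ) ^ j / γ) * ∑ p, c' p * (1 - reTr (GaugeField.plaqHol W p))) - (m Z - (Real.log (ρ (j + 1) (Us Z)) - Real.log (ρ' (j + 1) (Us Z))) - ((F.L : ℝ) ^ j / γ) * ∑ p, c' p * (1 - reTr (GaugeField.plaqHol Z p))))| ≤ w' * Real.exp (-(κ * (b.src.tdist b'.src : ℝ)))))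

/-- stub (MODE∘). -/
theorem stub_modeSection : ModeSectionCan := by
  sorry

/-- stub (TRM∘). -/
theorem stub_modeTransport : ModeTransportCan := by
  sorry

/-- stub (LAP∘). -/
theorem stub_laplaceCorrection : LaplaceCorrectionCan := by
  sorry

/-- ★M3 JUNCTION (kernel-checked, no sorry): transport through the mode section + Laplace correction re-assemble the tangent row LIN∘
(`OrganTangent.TangentTransportCan`, BY NAME).  `m = h∘U_m + (m − h∘U_m)` pointwise; `c′ := c⋆ + c″`, `a′ := a⋆ + a″`, `w′ := w⋆ + w″`,
`ε := εᵀ + εᴸ`, `εd := εdᵀ`, `δ := δᵀ + δᴸ` (floor class closed under `+`), `κ₀ := min`, `θ₀ := min`, `w₀ := min`, `γ₁ := min (min γᵀ γᴸ) 1`,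
`j₁ := max (max jᵀ jᴸ) jᴹ`; the section `U_m` is obtained from MODE∘ INSIDE the frame (the one change w.r.t. g25-2's ★3). -/
theorem tangentTransport_of_modeCut
    (hM : ModeSectionCan) (hB : ModeTransportCan) (hF : LaplaceCorrectionCan) :
    TangentTransportCan := by
  obtain ⟨γB, hγB, hB⟩ := hB
  obtain ⟨γF, hγF, hF⟩ := hF
  refine ⟨min (min γB γF) 1, lt_min (lt_min hγB hγF) one_pos, ?_⟩
  intro F γ hγ hγ1 b₀ p₀ j₀ prm η hb₀ hp₀ hadm hη0 hηs hηss hηt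
  have hγB' : γ ≤ γB := hγ1.trans ((min_le_left _ _).trans (min_le_left _ _))
  have hγF' : γ ≤ γF := hγ1.trans ((min_le_left _ _).trans (min_le_right _ _))
  have hγone : γ ≤ 1 := hγ1.trans (min_le_right _ _)
  obtain ⟨jM, hjM0, hM⟩ := hM F γ hγ hγone b₀ p₀ j₀ prm η hb₀ hp₀ hadm hη0 hηs hηss hηt
  obtain ⟨κB, hκB, hB⟩ := hB F γ hγ hγB' b₀ p₀ j₀ prm η hb₀ hp₀ hadm hη0 hηs hηss hηt
  obtain ⟨κF, hκF, hF⟩ := hF F γ hγ hγF' b₀ p₀ j₀ prm η hb₀ hp₀ hadm hη0 hηs hηss hηt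
  refine ⟨min κB κF, lt_min hκB hκF, ?_⟩
  intro κ hκ hκle
  obtain ⟨θB, hθB, hB⟩ := hB κ hκ (hκle.trans (min_le_left _ _))
  obtain ⟨θF, hθF, hF⟩ := hF κ hκ (hκle.trans (min_le_right _ _))
  refine ⟨min θB θF, lt_min hθB hθF, ?_⟩
  intro θ hθ hθle
  obtain ⟨wB, εB, εd, δB, jB, hwB, hnnB, hεBs, hεds, hδBs, hδBss, hδBt, hjB, hB⟩ :=
    hB θ hθ (hθle.trans (min_le_left _ _))
  obtain ⟨wF, εF, δF, jF, hwF, hnnF, hεFs, hδFs, hδFss, hδFt, hjF, hF⟩ :=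
    hF θ hθ (hθle.trans (min_le_right _ _))
  have h1 : ∀ i, Summable (fun k => δB (k + i)) := fun i => (summable_nat_add_iff i).mpr hδBs
  have h2 : ∀ i, Summable (fun k => δF (k + i)) := fun i => (summable_nat_add_iff i).mpr hδFs
  refine ⟨min wB wF, fun j => εB j + εF j, εd, fun j => δB j + δF j, max (max jB jF) jM, lt_min hwB hwF, ?_,
    hεBs.add hεFs, hεds, hδBs.add hδFs, ?_, ?_, hjB.trans ((le_max_left _ _).trans (le_max_left _ _)), ?_⟩
  · intro j
    exact ⟨add_nonneg (hnnB j).1 (hnnF j).1, (hnnB j).2.1, add_nonneg (hnnB j).2.2 (hnnF j).2⟩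
  · have key : (fun i => ∑' k, (δB (k + i) + δF (k + i))) =
        fun i => (∑' k, δB (k + i)) + ∑' k, δF (k + i) := by
      funext i
      exact (h1 i).tsum_add (h2 i)
    rw [key]
    exact hδBss.add hδFss
  · have key : (fun j => (∑' k, (δB (k + j) + δF (k + j))) * ((1 + 2 * ((F.L : ℝ) ^ j / γ) * (Fintype.card (Plaq (F.P j) 0) : ℝ)) * (Fintype.card (PBond (F.P j) 0) : ℝ) ^ 2)) =
        fun j => (∑' k, δB (k + j)) * ((1 + 2 * ((F.L : ℝ) ^ j / γ) * (Fintype.card (Plaq (F.P j) 0) : ℝ)) * (Fintype.card (PBond (F.P j) 0) : ℝ) ^ 2) +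
          (∑' k, δF (k + j)) * ((1 + 2 * ((F.L : ℝ) ^ j / γ) * (Fintype.card (Plaq (F.P j) 0) : ℝ)) * (Fintype.card (PBond (F.P j) 0) : ℝ) ^ 2) := by
      funext j
      rw [(h1 j).tsum_add (h2 j), add_mul]
    rw [key]
    simpa using hδBt.add hδFt
  · intro ν hG hCν K K' hKK' Ts T hTs hTK μ μ' ρ ρ' hanch hcut hcons hfin hwin j hj hjT hjTs σ hσM hσb hσf m hmc hmae c a w ha hw hx hin
    have hjB' : jB ≤ j := ((le_max_left _ _).trans (le_max_left _ _)).trans hj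
    have hjF' : jF ≤ j := ((le_max_right _ _).trans (le_max_left _ _)).trans hj
    have hjM' : jM ≤ j := (le_max_right _ _).trans hj
    obtain ⟨Us, hUc, hUs⟩ := hM ν hG hCν K K' hKK' Ts T hTs hTK μ μ' ρ ρ' hanch hcut hcons hfin hwin j hjM' hjT hjTs
    obtain ⟨c₁, a₁, w₁, ha₁, hw₁, hbd₁, hc₁, h4₁⟩ :=
      hB ν hG hCν K K' hKK' Ts T hTs hTK μ μ' ρ ρ' hanch hcut hcons hfin hwin j hjB' hjT hjTs Us hUc hUs c a w ha hw (hx.trans (min_le_left _ _)) hin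
    obtain ⟨c₂, a₂, w₂, ha₂, hw₂, hbd₂, hc₂, h4₂⟩ :=
      hF ν hG hCν K K' hKK' Ts T hTs hTK μ μ' ρ ρ' hanch hcut hcons hfin hwin j hjF' hjT hjTs σ hσM hσb hσf m hmc hmae Us hUc hUs c a w ha hw
        (hx.trans (min_le_right _ _)) hin
    refine ⟨fun p => c₁ p + c₂ p, a₁ + a₂, w₁ + w₂, add_nonneg ha₁ ha₂, add_nonneg hw₁ hw₂, ?_, ?_, ?_⟩
    · linear_combination hbd₁ + hbd₂
    · intro p
      exact (abs_add_le _ _).trans (add_le_add (hc₁ p) (hc₂ p))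
    · intro b b' U V W Z hU hV' hW hZ e1 e2 e3 e4
      have A := h4₁ b b' U V W Z hU hV' hW hZ e1 e2 e3 e4
      have B := h4₂ b b' U V W Z hU hV' hW hZ e1 e2 e3 e4
      have hsum := add_le_add A B
      rw [← add_mul] at hsum
      refine le_trans ?_ hsum
      refine le_trans (le_of_eq ?_) (abs_add_le _ _)
      congr 1
      simp only [add_mul, Finset.sum_add_distrib]
      ring

/-- ★M4 JUNCTION (organ_tangent v2.5's ★ `oneStepContractionRun_of_tangentCut`, re-proved here verbatim so that this file stands alone): VER∘ → LIN∘ → JEN∘ → O1. -/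
theorem oneStepContractionRun_of_tangentCut
    (hV : FibreMeanVersionCan) (hL : TangentTransportCan) (hJ : JensenGapCan) :
    OneStepContractionRun := by
  obtain ⟨γL, hγL, hL⟩ := hL
  obtain ⟨γJ, hγJ, hJ⟩ := hJ
  refine ⟨min (min γL γJ) 1, lt_min (lt_min hγL hγJ) one_pos, ?_⟩
  intro F γ hγ hγ1 b₀ p₀ j₀ prm η hb₀ hp₀ hadm hη0 hηs hηss hηt
  have hγone : γ ≤ 1 := hγ1.trans (min_le_right _ _)
  obtain ⟨jV, hV⟩ := hV F γ b₀ p₀ hγ hγone hb₀ hp₀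
  obtain ⟨κL, hκL, hL⟩ := hL F γ hγ (hγ1.trans ((min_le_left _ _).trans (min_le_left _ _))) b₀ p₀ j₀ prm η hb₀ hp₀ hadm hη0 hηs hηss hηt
  obtain ⟨κJ, hκJ, hJ⟩ := hJ F γ hγ (hγ1.trans ((min_le_left _ _).trans (min_le_right _ _))) b₀ p₀ j₀ prm η hb₀ hp₀ hadm hη0 hηs hηss hηt
  refine ⟨min κL κJ, lt_min hκL hκJ, ?_⟩
  intro κ hκ hκle
  obtain ⟨θL, hθL, hL⟩ := hL κ hκ (hκle.trans (min_le_left _ _))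
  obtain ⟨θJ, hθJ, hJ⟩ := hJ κ hκ (hκle.trans (min_le_right _ _))
  obtain ⟨wL, ε, εd, δL, jL, hwL, hnnL, hεs, hεds, hδLs, hδLss, hδLt, hjL, hL⟩ :=
    hL (min θL θJ) (lt_min hθL hθJ) (min_le_left _ _)
  obtain ⟨C, wJ, δJ, jJ, hC, hwJ, hnnJ, hδJs, hδJss, hδJt, hjJ, hJ⟩ :=
    hJ (min θL θJ) (lt_min hθL hθJ) (min_le_right _ _)
  have h1 : ∀ i, Summable (fun k => δL (k + i)) := fun i => (summable_nat_add_iff i).mpr hδLs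
  have h2 : ∀ i, Summable (fun k => δJ (k + i)) := fun i => (summable_nat_add_iff i).mpr hδJs
  refine ⟨min θL θJ, C, min wL wJ, ε, εd, fun j => δL j + δJ j, max (max jL jJ) jV, lt_min hθL hθJ, hC, lt_min hwL hwJ, ?_,
    hεs, hεds, hδLs.add hδJs, ?_, ?_, hjL.trans ((le_max_left jL jJ).trans (le_max_left (max jL jJ) jV)), ?_⟩
  · intro j
    exact ⟨(hnnL j).1, (hnnL j).2.1, add_nonneg (hnnL j).2.2 (hnnJ j)⟩
  · have key : (fun i => ∑' k, (δL (k + i) + δJ (k + i))) =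
        fun i => (∑' k, δL (k + i)) + ∑' k, δJ (k + i) := by
      funext i
      exact (h1 i).tsum_add (h2 i)
    rw [key]
    exact hδLss.add hδJss
  · have key : (fun j => (∑' k, (δL (k + j) + δJ (k + j))) * ((1 + 2 * ((F.L : ℝ) ^ j / γ) * (Fintype.card (Plaq (F.P j) 0) : ℝ)) * (Fintype.card (PBond (F.P j) 0) : ℝ) ^ 2)) =
        fun j => (∑' k, δL (k + j)) * ((1 + 2 * ((F.L : ℝ) ^ j / γ) * (Fintype.card (Plaq (F.P j) 0) : ℝ)) * (Fintype.card (PBond (F.P j) 0) : ℝ) ^ 2) +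
          (∑' k, δJ (k + j)) * ((1 + 2 * ((F.L : ℝ) ^ j / γ) * (Fintype.card (Plaq (F.P j) 0) : ℝ)) * (Fintype.card (PBond (F.P j) 0) : ℝ) ^ 2) := by
      funext j
      rw [(h1 j).tsum_add (h2 j), add_mul]
    rw [key]
    simpa using hδLt.add hδJt
  · intro ν hG hCν K K' hKK' Ts T hTs hTK μ μ' ρ ρ' hanch hcut hcons hfin hwin j hj hjT hjTs c a w ha hw hx hin
    obtain ⟨σ, hσM, hσb, hσf⟩ :=
      Summit.QuantumFields.YangMills.Theorems.BackwardLiouvilleRigidity.FibreLaplace.stub_descentDisintegration F j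
    have hjLJ : max jL jJ ≤ j := (le_max_left (max jL jJ) jV).trans hj
    have hj₀ : j₀ ≤ j := hjL.trans ((le_max_left jL jJ).trans hjLJ)
    have hjT' : j + 1 ≤ T := by omega
    obtain ⟨m, hmc, hmae⟩ :=
      hV j₀ prm η ν hG hCν K K' hKK' Ts T hTs hTK μ μ' ρ ρ' hanch hcut hcons hfin hwin j ((le_max_right (max jL jJ) jV).trans hj) hj₀ hjT' σ hσM hσb hσf
    obtain ⟨c', a', w₁, ha', hw₁, hbdL, hc', h4L⟩ :=
      hL ν hG hCν K K' hKK' Ts T hTs hTK μ μ' ρ ρ' hanch hcut hcons hfin hwin j ((le_max_left jL jJ).trans hjLJ) hjT hjTs σ hσM hσb hσf m hmc hmae c a w ha hw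
        (hx.trans (min_le_left _ _)) hin
    obtain ⟨w₂, hw₂, hbdJ, h4J⟩ :=
      hJ ν hG hCν K K' hKK' Ts T hTs hTK μ μ' ρ ρ' hanch hcut hcons hfin hwin j ((le_max_right jL jJ).trans hjLJ) hjT hjTs σ hσM hσb hσf m hmc hmae c a w ha hw
        (hx.trans (min_le_right _ _)) hin
    refine ⟨c', a', w₁ + w₂, ha', add_nonneg hw₁ hw₂, ?_, hc', ?_⟩
    · linear_combination hbdL + hbdJ
    · intro b b' U V W Z hU hV' hW hZ e1 e2 e3 e4
      have A := h4L b b' U V W Z hU hV' hW hZ e1 e2 e3 e4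
      have B := h4J b b' U V W Z hU hV' hW hZ e1 e2 e3 e4
      have hsum := add_le_add A B
      rw [← add_mul] at hsum
      refine le_trans ?_ hsum
      refine le_trans (le_of_eq ?_) (abs_add_le _ _)
      congr 1
      ring

/-- ★M5 JUNCTION (composition with organ_tangent's ★, re-proved above verbatim as ★M4): VER∘ → MODE∘ → TRM∘ → LAP∘ → JEN∘ → O1. -/
theorem oneStepContractionRun_of_modeCut
    (hV : FibreMeanVersionCan) (hM : ModeSectionCan) (hB : ModeTransportCan)
    (hF : LaplaceCorrectionCan) (hJ : JensenGapCan) : OneStepContractionRun :=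
  oneStepContractionRun_of_tangentCut hV (tangentTransport_of_modeCut hM hB hF) hJ

end Summit.QuantumFields.YangMills.Cruxes.FluctuationComparisonRegPrIntL.ModeSection
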